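/-
Copyright (c) 2026 the pub-hodgecm-mathlib formalisation cell (harness21).  Prover seat hodgecm-mathlib-F0P3a-p03 (g21), 2026-09-02 (LH7 leaf ED. 3 road, letters O8a ∕ O8b:
«a finite local component whose class at `v` is a CHARACTER is `χ_v`-ISOTYPIC on all of `U(Φ₂)(F_v)`», generic `E ∕ F`, any character).
-/
import Literature.NumberTheory.Automorphic.SmoothRepUniqueConstituentDetScalar          -- ★ p850416 (this seat): «DET-SCALAR» package
import Literature.NumberTheory.Automorphic.UnitaryGroupLocalDetScalar                   -- ★ p850430 (this seat): `scalar_det_mem_localPi`, `inclPlaceAdelic_scalar_det_mem_center`, det facts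
import Literature.NumberTheory.Automorphic.UnitaryGroupRankTwoNormOneGeneration         -- ★ p850502 (this seat): (SU-GEN)_v `UnitaryGroup.mk_mem_closure_isCompact_of_forall_det_eq_one`
import Literature.NumberTheory.Automorphic.UnitaryGroupCohomologicalForms               -- ★ `DiscreteAutomorphicRep.finRep`, `HasFinComponent`
import Literature.NumberTheory.Automorphic.HilbertRepCompactModCenterType               -- ★ `ClosedSubrep.exists_apply_eq_smul_of_mem_center` (Schur for central elements)
import HarnessLib

/-!
# A representation of `U(J)(𝔸_{F,f})` embedded in a discrete automorphic one, whose constituents at `v` are one character `χ_v`, is `χ_v`-isotypic on ALL of `U(J)(F_v)`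
# (`J = antidiag(1,1)`, any quadratic `E ∕ F`, any `χ_v`; [Rogawski1990] §13.3 p. 203)

Topic `NumberTheory/Automorphic`; namespace `Literature.NumberTheory.Automorphic.UnitaryGroup` (+ `DiscreteAutomorphicRep.…` dot-names).  THEOREMS ONLY: no definition, no named fact, no
instance, no notation, no `sorry`.  GENERIC form of the CM theorem ★ `F0P3cPKtupleU2LocalIsotypyFull.forall_finRep_smoothPart_inclPlace_apply_eq_smul_of_realises₂` (this seat, p850519),
in the currency of the letters O8a `PKsaU2Shape` ∕ ★ `OccursInDiscreteSpectrum` (`HasFinComponent σ`: an INJECTIVE intertwiner `σ → P|_{U(J)(𝔸_{F,f})}`) as well as O8b (`P^∞` itself):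

THE MATHEMATICS («DET-SCALAR» road).  `E ∕ F` quadratic, `c ≠ 1`, `J = antidiag(1,1) ∈ M₂(E)`, `P` a discrete automorphic representation of `U(J)`, `σ` a SMOOTH representation of
`U(J)(𝔸_{F,f})` on `W` with an injective intertwiner `ι : σ → P|_{U(J)(𝔸_{F,f})}`, `v` a finite place, `χ_v : U(J)(F_v) →* ℂˣ` with open kernel such that every constituent of
`σ|_{U(J)(F_v)}` (★ `IrrClass.IsConstituentOf`) is `⟦ℂ_{χ_v}⟧`.  Then `σ(ι_v g) w = χ_v(g) • w` for EVERY `g ∈ U(J)(F_v)`:  the determinant scalar `z_g = (det g_w · 1)_w ∈ U(J)(F_v)` (★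
`scalar_det_mem_localPi`) has `ι_v(z_g)` central in `U(J)(𝔸_F)` (★ `inclPlaceAdelic_scalar_det_mem_center`), so acts on the irreducible unitary `P` by a scalar (Schur, ★
`ClosedSubrep.exists_apply_eq_smul_of_mem_center`), hence on `W` by the same scalar (`ι` injective intertwiner, §1); `g g z_g⁻¹` and all commutators have norm-one determinants, hence lie in
`U(J)(F_v)° = ⟨compact subgroups⟩` (★ p850502 (SU-GEN)_v); ★ p850416 concludes.
* §1 `exists_apply_inclPlace_scalar_det_eq_smul_of_injective` — the scalar on `W`;
* §2 **`apply_inclPlace_eq_smul_of_forall_isConstituentOf_eq_of_injective`** — the isotypy on `W` (any `σ` with an injective intertwiner into `P.finRep`);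
* §3 **`DiscreteAutomorphicRep.finRep_smoothPart_inclPlace_apply_eq_smul_of_forall_isConstituentOf_eq`** — the case `σ = P^∞` (`P.finRep.smoothPart`, `ι` the inclusion): the constituents of
  `P^∞|_{U(J)(F_v)}` are `{⟦ℂ_{χ_v}⟧}` ⇒ ALL of `U(J)(F_v)` acts on `P^∞` through `χ_v` (+ the `L²`-vector form).
CONSUMERS (cell `hodgecm-mathlib`, crux H413, line LH7): O8a road («one-dimensional local class at `v` ⇒ `U(Φ₂)(L⁺_v)`, in particular `SU(Φ₂)(L⁺_v)`, acts through that character on the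
finite component»; with ★ strong approximation files this is the local input of the print argument), and the CM O8b file ★ p850519 (which this generalises to arbitrary `χ_v`).
HONEST LABEL: generic ([BushnellHenniart2006] §2.3, §9.1; [Rogawski1990] §13.3 p. 203; [PlatonovRapinchuk1994] §5.1); HC_CM is proved only modulo the printed citations of that programme
until its rung 0 closes; this file proves no printed citation of it.

## References
* [Rogawski1990] J. D. Rogawski, *Automorphic Representations of Unitary Groups in Three Variables* (1990), §13.3 pp. 199–203, §12.2 pp. 173–174.
* [BushnellHenniart2006] C. J. Bushnell, G. Henniart, *The local Langlands conjecture for GL(2)* (2006), §2.3 Lemma, §9.1.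
* [DeitmarEchterhoff2014] A. Deitmar, S. Echterhoff, *Principles of Harmonic Analysis*, 2nd ed. (2014), Lemma 6.1.7 (Schur).
* [PlatonovRapinchuk1994] V. Platonov, A. Rapinchuk, *Algebraic Groups and Number Theory* (1994), §3.3, §5.1, §7.1.
-/

set_option autoImplicit false

noncomputable section

open MeasureTheory NumberField IsDedekindDomain

namespace Literature.NumberTheory.Automorphic

namespace UnitaryGroup

variable (F E : Type) [Field F] [NumberField F] [Field E] [NumberField E] [Algebra F E]
variable (c : E ≃ₐ[F] E) (N : ℕ) (J : Matrix (Fin N) (Fin N) E)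

variable {F}

/-! ## §1 The determinant scalar acts by a scalar on any representation injectively intertwined into `P|_{U(J)(𝔸_{F,f})}` -/

/-- **Schur, transported along an injective intertwiner.**  For a discrete automorphic `P` of `U(J)` (`det J ≠ 0`), a representation `σ` of `U(J)(𝔸_{F,f})` on `W` with an INJECTIVE
intertwiner `ι : σ → P.finRep`, a finite place `v` and `g ∈ U(J)(F_v)`: the determinant scalar `z_g = (det g_w · 1_N)_w` acts on `W` through `σ ∘ inclPlace v` by a scalar — `ι_v(z_g)` is
central in `U(J)(𝔸_F)` (★ `inclPlaceAdelic_scalar_det_mem_center`), hence acts by a scalar on the irreducible unitary `P ≤ L²` (★ `ClosedSubrep.exists_apply_eq_smul_of_mem_center`), and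
`ι (σ (ι_v z_g) w) = P(ι_v z_g) (ι w)`. [cite: DeitmarEchterhoff2014, Lemma 6.1.7] [cite: PlatonovRapinchuk1994, §5.1] -/
theorem exists_apply_inclPlace_scalar_det_eq_smul_of_injective (hJ : J.det ≠ 0)
    {μ : Measure (adelicGroupData F E c N J).automorphicQuotient} [(adelicGroupData F E c N J).IsAutomorphicMeasure μ]
    (P : DiscreteAutomorphicRep (adelicGroupData F E c N J) μ)
    {W : Type} [AddCommGroup W] [Module ℂ W] (σ : Representation ℂ (finAdelic F E c N J) W) (ι : σ.IntertwiningMap P.finRep) (hι : Function.Injective ι)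
    (v : HeightOneSpectrum (𝓞 F)) (g : ↥(localPi E c N J v)) :
    ∃ a : ℂ, ∀ w : W, σ (inclPlace F E c N J v ⟨fun w' : PlacesOver E v =>
        Units.map (Matrix.scalar (Fin N) : w'.1.adicCompletion E →+* Matrix (Fin N) (Fin N) (w'.1.adicCompletion E)).toMonoidHom
          (Matrix.GeneralLinearGroup.det ((g : LocalGLPi E N v) w')), scalar_det_mem_localPi E c N J hJ v g⟩) w = a • w := by
  have hz := inclPlaceAdelic_scalar_det_mem_center E c N J hJ v g
  obtain ⟨a, ha⟩ := ContRepresentation.ClosedSubrep.exists_apply_eq_smul_of_mem_center ((adelicGroupData F E c N J).isUnitary_rightRegular μ) P.irreducible hz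
  refine ⟨a, fun w => hι ?_⟩
  rw [ι.isIntertwining, map_smul]
  -- `P.finRep (inclPlace v z) (ι w) = R(ι_v z) (ι w) = a • ι w` in `L²`
  exact Subtype.ext (ha _ (ι w).2)

/-! ## §2 `J = antidiag(1,1)`: unique constituent `⟦ℂ_{χ_v}⟧` at `v` ⇒ ALL of `U(J)(F_v)` acts on `W` through `χ_v` -/

variable [Algebra.IsQuadraticExtension F E]

/-- **LOCAL CHARACTER ISOTYPY (injective-intertwiner form).**  `E ∕ F` quadratic, `c ≠ 1`, `J = antidiag(1,1)`; `P` discrete automorphic, `σ` a SMOOTH representation of `U(J)(𝔸_{F,f})`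
with an injective intertwiner into `P.finRep` (e.g. the finite component of ★ `OccursInDiscreteSpectrum` ∕ `HasFinComponent`), `χ : U(J)(F_v) →* ℂˣ` with open kernel, and every
constituent of `σ ∘ inclPlace v` equal to `⟦ℂ_χ⟧`.  Then `σ (inclPlace v g) w = χ(g) • w` for EVERY `g ∈ U(J)(F_v)` (★ p850416 with the scalar of §1 and (SU-GEN)_v ★ p850502).
[cite: Rogawski1990, §13.3 p. 203] [cite: BushnellHenniart2006, §2.3 Lemma; §9.1] -/
theorem apply_inclPlace_eq_smul_of_forall_isConstituentOf_eq_of_injective (hc : c ≠ 1) {J : Matrix (Fin 2) (Fin 2) E} (hJ2 : J = !![0, 1; 1, 0])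
    {μ : Measure (adelicGroupData F E c 2 J).automorphicQuotient} [(adelicGroupData F E c 2 J).IsAutomorphicMeasure μ]
    (P : DiscreteAutomorphicRep (adelicGroupData F E c 2 J) μ)
    {W : Type} [AddCommGroup W] [Module ℂ W] (σ : Representation ℂ (finAdelic F E c 2 J) W) (hσ : σ.IsSmooth) (ι : σ.IntertwiningMap P.finRep) (hι : Function.Injective ι)
    (v : HeightOneSpectrum (𝓞 F)) (χ : ↥(localPi E c 2 J v) →* ℂˣ) (hχ : IsOpen ((χ.ker : Subgroup ↥(localPi E c 2 J v)) : Set ↥(localPi E c 2 J v)))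
    (hconst : ∀ c₀ : IrrClass ↥(localPi E c 2 J v), c₀.IsConstituentOf (σ.comp (inclPlace F E c 2 J v)) → c₀ = IrrClass.mk (SmoothIrrep.ofChar χ hχ))
    (g : ↥(localPi E c 2 J v)) (w : W) :
    σ (inclPlace F E c 2 J v g) w = ((χ g : ℂˣ) : ℂ) • w := by
  have hJ : J.det ≠ 0 := by subst hJ2; rw [Matrix.det_fin_two_of]; norm_num
  -- (SU-GEN)_v feeds the two closure hypotheses of ★ p850416 (subgroup arithmetic moved to the ambient tuples by `Subgroup.coe_mul` ∕ `coe_inv`)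
  have hcen : ∀ t : ↥(localPi E c 2 J v), ∃ (z : ↥(localPi E c 2 J v)) (a : ℂ),
      (∀ w : W, (σ.comp (inclPlace F E c 2 J v)) z w = a • w) ∧
        t * t * z⁻¹ ∈ Subgroup.closure (⋃ K ∈ {K : Subgroup ↥(localPi E c 2 J v) | IsCompact (K : Set ↥(localPi E c 2 J v))}, (K : Set ↥(localPi E c 2 J v))) := fun t => by
    refine ⟨⟨fun w' : PlacesOver E v =>
        Units.map (Matrix.scalar (Fin 2) : w'.1.adicCompletion E →+* Matrix (Fin 2) (Fin 2) (w'.1.adicCompletion E)).toMonoidHom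
          (Matrix.GeneralLinearGroup.det ((t : LocalGLPi E 2 v) w')), scalar_det_mem_localPi E c 2 J hJ v t⟩,
      (exists_apply_inclPlace_scalar_det_eq_smul_of_injective E c 2 J hJ P σ ι hι v t).imp fun a ha => ⟨ha, ?_⟩⟩
    have hmem := UnitaryGroup.mk_mem_closure_isCompact_of_forall_det_eq_one E c hc hJ2 v
      ((t : LocalGLPi E 2 v) * (t : LocalGLPi E 2 v) * (fun w' : PlacesOver E v =>
        Units.map (Matrix.scalar (Fin 2) : w'.1.adicCompletion E →+* Matrix (Fin 2) (Fin 2) (w'.1.adicCompletion E)).toMonoidHom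
          (Matrix.GeneralLinearGroup.det ((t : LocalGLPi E 2 v) w')))⁻¹)
      (mul_mem (mul_mem t.2 t.2) (inv_mem (scalar_det_mem_localPi E c 2 J hJ v t)))
      fun w' => det_apply_mul_mul_scalar_det_inv_eq_one E v (t : LocalGLPi E 2 v) w'
    have heq : t * t * (⟨fun w' : PlacesOver E v =>
        Units.map (Matrix.scalar (Fin 2) : w'.1.adicCompletion E →+* Matrix (Fin 2) (Fin 2) (w'.1.adicCompletion E)).toMonoidHom
          (Matrix.GeneralLinearGroup.det ((t : LocalGLPi E 2 v) w')), scalar_det_mem_localPi E c 2 J hJ v t⟩ : ↥(localPi E c 2 J v))⁻¹ =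
        ⟨_, mul_mem (mul_mem t.2 t.2) (inv_mem (scalar_det_mem_localPi E c 2 J hJ v t))⟩ :=
      Subtype.ext (by simp only [Subgroup.coe_mul, Subgroup.coe_inv])
    rw [heq]
    exact hmem
  have hcomm : ∀ k t : ↥(localPi E c 2 J v),
      k⁻¹ * t⁻¹ * k * t ∈ Subgroup.closure (⋃ K ∈ {K : Subgroup ↥(localPi E c 2 J v) | IsCompact (K : Set ↥(localPi E c 2 J v))}, (K : Set ↥(localPi E c 2 J v))) :=
    fun k t => by
    have hmem := UnitaryGroup.mk_mem_closure_isCompact_of_forall_det_eq_one E c hc hJ2 v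
      ((k : LocalGLPi E 2 v)⁻¹ * (t : LocalGLPi E 2 v)⁻¹ * (k : LocalGLPi E 2 v) * (t : LocalGLPi E 2 v))
      (mul_mem (mul_mem (mul_mem (inv_mem k.2) (inv_mem t.2)) k.2) t.2)
      fun w' => det_apply_commutator_eq_one E 2 v (t : LocalGLPi E 2 v) (k : LocalGLPi E 2 v) w'
    have heq : k⁻¹ * t⁻¹ * k * t = ⟨_, mul_mem (mul_mem (mul_mem (inv_mem k.2) (inv_mem t.2)) k.2) t.2⟩ :=
      Subtype.ext (by simp only [Subgroup.coe_mul, Subgroup.coe_inv])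
    rw [heq]
    exact hmem
  exact IrrClass.apply_eq_smul_of_forall_isConstituentOf_eq_mk_ofChar_of_forall_exists_sq_mul_inv_mem_closure (σ.comp (inclPlace F E c 2 J v))
    (hσ.comp _ (continuous_inclPlace F E c 2 J v)) χ hχ hconst hcen hcomm g w

/-! ## §3 The case `σ = P^∞` -/

/-- **LOCAL CHARACTER ISOTYPY FOR `P^∞`.**  `E ∕ F` quadratic, `c ≠ 1`, `J = antidiag(1,1)`; `P` discrete automorphic, `v` finite, `χ : U(J)(F_v) →* ℂˣ` with open kernel; if every
constituent of `P^∞|_{U(J)(F_v)}` (`P.finRep.smoothPart ∘ inclPlace v`) is `⟦ℂ_χ⟧`, then `P.finRep (inclPlace v g) f = χ(g) • f` for EVERY `g ∈ U(J)(F_v)` and every finite-adelic smooth `f`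
(§2 with `σ = P^∞` and the inclusion).  For `χ = ((η ψ) ∘ det) ∘ ι_v` and `Realises₂` this is ★ p850519. [cite: Rogawski1990, §13.3 p. 203] [cite: BushnellHenniart2006, §2.3 Lemma; §9.1] -/
theorem _root_.Literature.NumberTheory.Automorphic.DiscreteAutomorphicRep.finRep_smoothPart_inclPlace_apply_eq_smul_of_forall_isConstituentOf_eq (hc : c ≠ 1)
    {J : Matrix (Fin 2) (Fin 2) E} (hJ2 : J = !![0, 1; 1, 0])
    {μ : Measure (adelicGroupData F E c 2 J).automorphicQuotient} [(adelicGroupData F E c 2 J).IsAutomorphicMeasure μ]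
    (P : DiscreteAutomorphicRep (adelicGroupData F E c 2 J) μ)
    (v : HeightOneSpectrum (𝓞 F)) (χ : ↥(localPi E c 2 J v) →* ℂˣ) (hχ : IsOpen ((χ.ker : Subgroup ↥(localPi E c 2 J v)) : Set ↥(localPi E c 2 J v)))
    (hconst : ∀ c₀ : IrrClass ↥(localPi E c 2 J v), c₀.IsConstituentOf (P.finRep.smoothPart.toRepresentation.comp (inclPlace F E c 2 J v)) →
      c₀ = IrrClass.mk (SmoothIrrep.ofChar χ hχ))
    (g : ↥(localPi E c 2 J v)) (f : ↥P.finRep.smoothPart.toSubmodule) :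
    P.finRep.smoothPart.toRepresentation (inclPlace F E c 2 J v g) f = ((χ g : ℂˣ) : ℂ) • f := by
  -- the inclusion `P^∞ ↪ P.finRep` as an (injective) intertwiner
  let ι : P.finRep.smoothPart.toRepresentation.IntertwiningMap P.finRep :=
    LinearMap.intertwiningMap_of_isIntertwiningMap P.finRep.smoothPart.toRepresentation P.finRep P.finRep.smoothPart.toSubmodule.subtype fun _ _ => rfl
  have hι : Function.Injective ι := fun x y h => Subtype.ext h
  exact apply_inclPlace_eq_smul_of_forall_isConstituentOf_eq_of_injective E c hc hJ2 P P.finRep.smoothPart.toRepresentation P.finRep.isSmooth_smoothPart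
    ι hι v χ hχ hconst g f

/-- **The same on the `L²` vectors**: `R(ι_v g) f = χ(g) • f` for every `g ∈ U(J)(F_v)` and every finite-adelic smooth `f ∈ P`. [cite: Rogawski1990, §13.3 p. 203] -/
theorem _root_.Literature.NumberTheory.Automorphic.DiscreteAutomorphicRep.toContRep_inclPlaceAdelic_apply_eq_smul_of_forall_isConstituentOf_eq (hc : c ≠ 1)
    {J : Matrix (Fin 2) (Fin 2) E} (hJ2 : J = !![0, 1; 1, 0])
    {μ : Measure (adelicGroupData F E c 2 J).automorphicQuotient} [(adelicGroupData F E c 2 J).IsAutomorphicMeasure μ]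
    (P : DiscreteAutomorphicRep (adelicGroupData F E c 2 J) μ)
    (v : HeightOneSpectrum (𝓞 F)) (χ : ↥(localPi E c 2 J v) →* ℂˣ) (hχ : IsOpen ((χ.ker : Subgroup ↥(localPi E c 2 J v)) : Set ↥(localPi E c 2 J v)))
    (hconst : ∀ c₀ : IrrClass ↥(localPi E c 2 J v), c₀.IsConstituentOf (P.finRep.smoothPart.toRepresentation.comp (inclPlace F E c 2 J v)) →
      c₀ = IrrClass.mk (SmoothIrrep.ofChar χ hχ))
    (g : ↥(localPi E c 2 J v)) (f : ↥P.space.toSubmodule) (hf : f ∈ P.finRep.smoothPart) :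
    P.space.toContRep (inclPlaceAdelic F E c 2 J v g) f = ((χ g : ℂˣ) : ℂ) • f :=
  congrArg Subtype.val (DiscreteAutomorphicRep.finRep_smoothPart_inclPlace_apply_eq_smul_of_forall_isConstituentOf_eq E c hc hJ2 P v χ hχ hconst g ⟨f, hf⟩)

end UnitaryGroup

end Literature.NumberTheory.Automorphic

end
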